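import Mathlib.RingTheory.LaurentSeries
import Mathlib.Algebra.MvPolynomial.Equiv
import Literature.Computability.AlgebraicComplexity.ElusiveSymbolic
import Summits.ValiantsHypothesis.ValiantsHypothesis.Theorems.BinomialElusiveNumericToPuiseux
import Summits.ValiantsHypothesis.ValiantsHypothesis.Theses.GirthSidon

/-!
# Route GirthSidon — crux `MomentCurveElusive`, stub `stub_monomialNumericToPuiseux`
(numeric-to-Puiseux transfer for monomial curves)

Route `route-ValiantsHypothesis-GirthSidon`, item `stmt-ValiantsHypothesis-6534` (support for the
line TRANSFER → SMALL SUMSET COVER → GIRTH → VANDERMONDE of the birth skeleton).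

If the monomial curve `x ↦ (x^{d_i})_{i<m}` is not `(s,2)`-elusive over `ℂ` (Raz; tree
`IsElusive`), i.e. its image lies in the image of a quadratic polynomial map `Γ : ℂ^s → ℂ^m`, then
for some `N ≥ 1`, some quadratic `Γ` and Laurent series `y ∈ ℂ((t))^s` one has
`Γ_i(y(t)) = t^{N d_i}` in `ℂ((t))` for every `i` (`stub_monomialNumericToPuiseux`).

Proof: GMOW 2019 Lemma 9.3 for monomial curves
(`Literature.Computability.AlgebraicComplexity.exists_aeval_eq_X_pow_of_not_isElusive`, proved via
Prop. 3.3 / Nullstellensatz) gives a quadratic `Γ` and algebraic functions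
`b₁(x), …, b_s(x) ∈ \overline{ℂ(x)}` with `x^{d_i} = Γ_i(b(x))`; the Puiseux parametrisation of
finitely many algebraic functions
(`Summit.ValiantsHypothesis.Theorems.exists_laurent_relation_transfer`, proved via Newton–Puiseux)
specialises every polynomial relation `G(x, b) = 0` along `x ↦ tᴺ`, `b ↦ y(t)`; applied to
`G = x^{d_i} − Γ_i` it gives `Γ_i(y) = (tᴺ)^{d_i} = t^{N d_i}`. This is the monomial twin of
`Summit.ValiantsHypothesis.Theorems.numericToPuiseux_proof` (binomial curves, route
`BinomialElusive`).
-/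

-- Sub = Summit layout duplicates the namespace component
set_option linter.dupNamespace false

namespace Summit.ValiantsHypothesis.ValiantsHypothesis.Theorems

open HahnSeries (single)

/-- **Numeric-to-Puiseux transfer for monomial curves** (stub `stub_monomialNumericToPuiseux` of
crux `MomentCurveElusive`, item `stmt-ValiantsHypothesis-6534`): if the monomial curve
`x ↦ (x^{d_i})_{i<m}` is not `(s,2)`-elusive over `ℂ`, then for some `N ≥ 1`, some quadratic
`Γ : ℂ^s → ℂ^m` and Laurent series `y ∈ ℂ((t))^s`, `Γ_i(y) = t^{N d_i}` for every `i`.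
Proof: GMOW 2019 Lemma 9.3 (`exists_aeval_eq_X_pow_of_not_isElusive`) gives
`x^{d_i} = Γ_i(b(x))` over `\overline{ℂ(x)}`; the Puiseux parametrisation
`exists_laurent_relation_transfer` (Newton–Puiseux) specialises it along `x ↦ tᴺ`, `b ↦ y(t)`.
[folklore] -/
theorem stub_monomialNumericToPuiseux :
    ∀ (m s : ℕ) (d : Fin m → ℕ),
      ¬ Literature.Computability.AlgebraicComplexity.IsElusive
          (fun i : Fin m => (MvPolynomial.X 0 : MvPolynomial (Fin 1) ℂ) ^ d i) s 2 →
      ∃ (N : ℕ) (Γ : Fin m → MvPolynomial (Fin s) ℂ) (y : Fin s → LaurentSeries ℂ),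
        0 < N ∧ (∀ i, (Γ i).totalDegree ≤ 2) ∧
          ∀ i, MvPolynomial.aeval y (Γ i) = HahnSeries.single ((N * d i : ℕ) : ℤ) (1 : ℂ) := by
  intro m s d h
  classical
  obtain ⟨Γ, b, hΓ, hb⟩ :=
    Literature.Computability.AlgebraicComplexity.exists_aeval_eq_X_pow_of_not_isElusive d h
  obtain ⟨N, hN, p, hp⟩ := Summit.ValiantsHypothesis.Theorems.exists_laurent_relation_transfer b
  refine ⟨N, Γ, p, hN, hΓ, fun i => ?_⟩
  have key := hp (MvPolynomial.rename Sum.inl ((MvPolynomial.X 0 : MvPolynomial (Fin 1) ℂ) ^ d i) -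
      MvPolynomial.rename Sum.inr (Γ i)) (by
    rw [map_sub, MvPolynomial.aeval_rename, MvPolynomial.aeval_rename, sub_eq_zero,
      Sum.elim_comp_inl, Sum.elim_comp_inr, map_pow, MvPolynomial.aeval_X]
    exact hb i)
  rw [map_sub, MvPolynomial.aeval_rename, MvPolynomial.aeval_rename, sub_eq_zero,
    Sum.elim_comp_inl, Sum.elim_comp_inr] at key
  rw [← key]
  simp only [map_pow, MvPolynomial.aeval_X, HahnSeries.single_pow, one_pow]
  push_cast
  rw [nsmul_eq_mul, mul_comm (d i : ℤ)]

end Summit.ValiantsHypothesis.ValiantsHypothesis.Theorems
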